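import Summits.ABC.IUTFork.LDHGenuinePerImageSufficiencyFloor
import Summits.ABC.IUTFork.LDHGenuinePerImageShellDatum
import HarnessLib

/-!
# The fork at [IUTchIII] Corollary 3.12, L-DH level, READING (P): the Step (ii) bound with PER-PRIME FLOORS on the different exponent AND the
# wild LOG-SHELL term, at a genuine Θ-volume datum (abc-iut cell, crux ThetaPartII = stmt-ABC-19678; R-H round-4 row O-18, family
# «C:PERIMAGE-LEVEL», the sufficiency half for the pole-`l` + shell composition)

Record-only PROOF file (D-0012) of the abc-iut cell (seat abc-iut-L5-t8, gen 14). TAKES NO SIDE on [IUTchIII] Cor. 3.12. abc-iut-C-cert-1's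
`ThetaVolumeDatumAt.cor312PerImageOf_of_le_floor` (`LDHGenuinePerImageSufficiencyFloor`; floors `B_p·e(w∣p) ≤ ord_w 𝔇_{K/ℤ}`, no shell) and
abc-iut-c312-d1's `ThetaVolumeDatumAt.cor312PerImageOf_of_le_weighted_shell` (`LDHGenuinePerImageShellDatum`; ramification weights + the shell
sum `Σ_{p∈T(I)} ((l+5)/4)·Σ_{u∣p} Pr(u)·S_p(u)` of `GenuineContent.cor312PerImageOf_of_le_mul_ndeg_add_shell`) are the two Step (ii) currencies of
the cell; no landed theorem carries BOTH a floor on the different exponent (e.g. the pole-`l` weight `2 − 1/(l−1)` of ★ p539739, the wild `2`,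
the W1 poles) AND the shell term. THIS FILE is that merge, BY NAME (`ndeg_differentDivisor_ge_sum_floor` + `cor312PerImageOf_of_le_mul_ndeg_add_shell`;
the closing lines are adapted from `cor312PerImageOf_of_le_weighted_shell`):

* **`Cor22.ThetaVolumeDatumAt.cor312PerImageOf_of_le_floor_shell`** — `λ ∈ U_X`, `d_mod ≤ (l+5)/4`, a finite set `S` of rational primes
  with real floors `B_p` (`B_p·e(w∣p) ≤ ord_w 𝔇_{K/ℤ}` at every place `w ∣ p` of the datum's `K`), a shell function `Sf` on the places of
  `F_mod` dominated by shell pairs of the completions; if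
  `κ_l·log q^{∤2l}(λ) ≤ ((l+5)/4 − d_mod)·Σ_{p∈S} B_p·log p + Σ_{p∈T(I)} ((l+5)/4)·Σ_{u∣p} Pr(u)·Sf_p(u) + ((l+5)/4)·log π`
  then `T.Cor312PerImageOf`.

Classical bookkeeping around the cell's typed objects; nothing here asserts the existence of Θ-data, Cor. 3.12 in general or in print's
reading, or abc; proved-as-typed ≠ in print. [cite: Mochizuki2012, IUTchIII Cor. 3.12 p. 173–174, proof Step (x) p. 181; IUTchIV Def. 1.9
p. 21, Prop. 1.2 (i)(ii) p. 10, Thm. 1.10 Step (ii) p. 24, Step (v) p. 27–29, Step (vii) p. 30] [claim: Mochizuki2012, status: disputed] for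
every IUT quotation. PROOF-ONLY: no definitions, no new `Prop`, no instance, no notation.
-/

noncomputable section

open NumberField IsDedekindDomain Ideal Module

namespace Literature.IUT.LogVolume.Cor22

open Literature.NumberTheory.DiophantineGeometry.GenEll Summit.ABC.IUTFork Literature.IUT.HodgeTheaters
open Literature.NumberTheory.NumberFields Literature.NumberTheory.GaloisRepresentations.Ultrametric
open Literature.NumberTheory.DiophantineGeometry.UniformABCConjecture Rat.HeightOneSpectrum

namespace ThetaVolumeDatumAt

variable {P : NFPoint} {l : ℕ} (T : ThetaVolumeDatumAt P l)

/-- **THE SUFFICIENT HALF OF THE (P)-LINE CRUX AT A DATUM, FLOORS + SHELL FORM**: `λ ∈ U_X`, `d_mod ≤ (l+5)/4`, `S` a finite set of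
rational primes with real floors `B_p` such that `B_p·e(w∣p) ≤ ord_w(𝔇_{K/ℤ})` for every place `w ∣ p ∈ S` of the datum's `K`, and a shell
function `Sf` dominated by a shell pair at every completion of `F_mod`; if
`((l+1)/24 − 1/(2l))·log q^{∤2l}(λ) ≤ ((l+5)/4 − d_mod)·Σ_{p∈S} B_p·log p + Σ_{p∈T(I)} ((l+5)/4)·Σ_{u∣p} Pr(u)·Sf_p(u) + ((l+5)/4)·log π`
then [IUTchIII] Cor. 3.12 holds IN READING (P) at `T`. [cite: Mochizuki2012, IUTchIII Cor. 3.12 p. 173–174]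
[cite: Mochizuki2012, IUTchIV Thm. 1.10 Step (ii) p. 24, Step (v) p. 27–29, Step (vii) p. 30] [claim: Mochizuki2012, status: disputed] -/
theorem cor312PerImageOf_of_le_floor_shell (hU : P.InU) (hd : (dmod P : ℝ) ≤ ((l : ℝ) + 5) / 4)
    (S : Finset ℕ) (hS : ∀ p ∈ S, p.Prime) (B : ℕ → ℝ)
    (hB : letI := T.instFieldK; letI := T.instNumberFieldK
      ∀ p ∈ S, ∀ w ∈ placesOver T.K p,
        B p * (w.asIdeal.ramificationIdx ℤ : ℝ) ≤ (multiplicity w.asIdeal (differentIdeal ℤ (𝓞 T.K)) : ℝ))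
    (Sf : letI := T.instFieldF; letI := T.instNumberFieldF; letI := T.instIsElliptic
      (p : ℕ) → placesOver (fieldOfModuli T.E) p → ℝ)
    (hSf : letI := T.instFieldF; letI := T.instNumberFieldF; letI := T.instAlgebraF; letI := T.instFieldK
      letI := T.instNumberFieldK; letI := T.instAlgebraK; letI := T.instIsElliptic
      ∀ (p : ℕ) [hp : Fact p.Prime] (u : placesOver (fieldOfModuli T.E) p),
        ∃ c z : (T.I.σ.localFieldFamily p hp.out).k u,
          c ≠ 0 ∧ (∀ o : (T.I.σ.localFieldFamily p hp.out).k u, ‖o‖ ≤ 1 → c * o ∈ logUnits _) ∧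
          (∃ (ϖ : ((T.I.σ.localFieldFamily p hp.out).k u)ˣ) (w : (T.I.σ.localFieldFamily p hp.out).k u),
            IsUniformizer ϖ ∧ w ∉ logUnits _ ∧ ‖w‖ * ‖(ϖ : (T.I.σ.localFieldFamily p hp.out).k u)‖ ≤ ‖c‖) ∧
          z ≠ 0 ∧ z ∈ logUnits _ ∧ Sf p u ≤ Real.log ‖z‖ - Real.log ‖c‖)
    (h : letI := T.instFieldF; letI := T.instNumberFieldF; letI := T.instFieldK; letI := T.instNumberFieldK
      letI := T.instAlgebraK; letI := T.instIsElliptic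
      (((l : ℝ) + 1) / 24 - 1 / (2 * l)) * logQAvoid P {2, l} ≤
      (((l : ℝ) + 5) / 4 - dmod P) * (∑ p ∈ S, B p * Real.log p)
        + ∑ p ∈ T.I.supportPrimes, (((l : ℝ) + 5) / 4) *
            ∑ u : placesOver (fieldOfModuli T.E) p, weight (fieldOfModuli T.E) u.1 * Sf p u
        + ThetaVolumeInput.archLogTheta l) :
    T.Cor312PerImageOf := by
  -- adapted from abc-iut-c312-d1's `cor312PerImageOf_of_le_weighted_shell` (LDHGenuinePerImageShellDatum.lean), the different bound
  -- replaced by abc-iut-C-cert-1's floors `ndeg_differentDivisor_ge_sum_floor` (LDHGenuinePerImageSufficiencyFloor.lean)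
  letI := T.instFieldF; letI := T.instNumberFieldF; letI := T.instAlgebraF; letI := T.instFieldK
  letI := T.instNumberFieldK; letI := T.instAlgebraK; letI := T.instFieldFbar; letI := T.instAlgebraFbar
  letI := T.instAlgebraKFbar; letI := T.instIsElliptic
  haveI := T.isGalois_fieldOfModuli_K
  have hgap := PointDict.gap_eq T hU
  have hXlN : T.I.X.l = l := T.isVolumeInputOf.l_eq
  have hXl : ((T.I.X.l : ℕ) : ℝ) = (l : ℝ) := by exact_mod_cast hXlN
  have hls : ((T.I.X.lstar : ℝ) + 3) / 2 = ((l : ℝ) + 5) / 4 := by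
    have h2 : T.I.X.l = 2 * T.I.X.lstar + 1 := T.I.X.l_eq
    have h2R : ((T.I.X.l : ℕ) : ℝ) = 2 * (T.I.X.lstar : ℝ) + 1 := by exact_mod_cast h2
    rw [hXl] at h2R
    linarith
  have hdm : (Module.finrank ℚ (fieldOfModuli T.E) : ℝ) = (dmod P : ℝ) := by
    exact_mod_cast PointStepV.finrank_fieldOfModuli_eq_dmod T
  -- the floors bound at the datum
  have hdiff := ndeg_differentDivisor_ge_sum_floor T.K S hS B hB
  have hc : 0 ≤ ((l : ℝ) + 5) / 4 - (dmod P : ℝ) := by linarith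
  have hmono := mul_le_mul_of_nonneg_left hdiff hc
  show T.I.Cor312PerImageOf
  refine GenuineContent.cor312PerImageOf_of_le_mul_ndeg_add_shell T.I Sf hSf ?_
  rw [hXl, hls, hdm]
  have hg : T.gap = (((l : ℝ) + 1) / 24 - 1 / (2 * l)) * FinDivisor.ndeg (fieldOfModuli T.E) T.I.X.qDivisor := by
    show LgpDivisor.ndegLgp T.I.X.thetaPilot - FinDivisor.ndeg _ T.I.X.qPilot = _
    rw [DHData.ndegLgp_thetaPilot_eq, PilotData.qPilot_eq_smul, map_smul, smul_eq_mul, hXl]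
    ring
  rw [← hg, hgap]
  show _ ≤ _ + ThetaVolumeInput.archLogTheta T.I.X.l
  rw [hXlN]
  linarith

end ThetaVolumeDatumAt

end Literature.IUT.LogVolume.Cor22

end
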